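import Literature.Computability.Complexity.ProofComplexityNPProofs
import HarnessLib

/-!
# Proofs: `TAUT` has a Cook–Reckhow proof system

Sibling proof file of `ProofSystems.lean` (D-0014: named facts `def X : Prop` are discharged as
`theorem X_holds : X`). It discharges

* `Literature.Computability.MetaComplexity.exists_isProofSystemFor_TAUT_holds :
  exists_isProofSystemFor_TAUT` — the language `TAUT` (codewords, under `encodingPropForm`, of
  propositional tautologies) has a proof system in verifier form: a polynomial-time verifier
  `V` with `x ∈ TAUT ↔ ∃ π, V x π = true` for *all* strings `x`.

It is a separate sibling (not part of `ProofSystemsProofs.lean`) because the witness is the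
string-level verifier for `textbookFrege` proofs of
`MetaComplexity/FregeVerifier{Model,Complete,Bricks,Machine}.lean`, packaged as
`Literature.Computability.Complexity.textbookFrege_hasPolyTimeVerifier_holds` in
`Complexity/ProofComplexityNPProofs.lean`, whose import closure contains `ProofSystemsProofs.lean`.

## Source and printed argument

S. A. Cook, R. A. Reckhow, *The relative efficiency of propositional proof systems*,
J. Symbolic Logic 44 (1979) 36–50, §1:

* Definition 1.3: "If `L ⊆ Σ*`, a proof system for `L` is a function `f : Σ₁* → L` for some
  alphabet `Σ₁` and `f` in `𝓛` [polynomial time] such that `f` is onto."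
* Closing remark of §1: "It is easy to see (and is argued below) that any conventional proof
  system for tautologies can naturally be made to fit the definition of proof system in 1.3",
  and, below: "formulas can be naturally regarded as strings over a finite alphabet … an atom
  itself must be regarded as a string (say the letter P followed by a string over `{0, 1}`) … a
  proof `π` … can naturally be regarded as a string over a finite alphabet which includes the
  comma as a separator symbol … The function `f` which abstractly specifies the system would be
  given by `f(π) = A` if `π` proves `A`, and `f(π) = A₀` for some fixed tautology `A₀` if `π` is
  a string not corresponding to a proof in the system"; and (proof sketch of Prop. 1.1) "For
  any reasonable logical theory, this verification can be performed within time bounded by some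
  polynomial in `n`."

The tree realises this for the concrete Frege system `textbookFrege` in the (equivalent)
verifier form of `IsProofSystemFor`: `textbookFrege_hasPolyTimeVerifier_holds` provides a
polynomial-time verifier `V` which is sound on codewords (`V (encode φ) c = true → φ` is a
tautology) and complete (every `textbookFrege`-proof of `φ` yields an accepted certificate);
`tautVerifier V w c := !(chkTaut w []) && V w c` (`ProofComplexityNP.lean`) adds the
polynomial-time codeword test, so that non-codewords — which are not in `TAUT` — have no proofs
(`mem_range_encode_of_chkTaut_nil`, `chkTaut_nil_eq_false_of_mem_TAUT`,
`isPolyTimeVerifier_tautVerifier`); completeness of `textbookFrege` for tautologies is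
`FregeSystem.provable_iff_isTautology` with `isFrege_textbookFrege_holds` (Shoenfield's
completeness theorem, `TextbookFregeCompleteness.lean`).

Deliberately not here: polynomial boundedness of this system (open; equivalent to `NP = coNP`
for Frege systems only conjecturally) and the comparison with `FregeSystem.IsPolyBounded`
(`exists_isProofSystemFor_of_isFrege`, `Frege.lean`).
-/

namespace Literature.Computability.MetaComplexity

open _root_.Computability Complexity

/-- **The Frege-based verifier is a proof system for `TAUT`.** For any verifier `V` as in
`textbookFrege_hasPolyTimeVerifier` (polynomial time, sound on codewords, complete for
`textbookFrege`-proofs), the combined verifier `tautVerifier V` (codeword test AND `V`) is a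
Cook–Reckhow proof system for `TAUT` on all strings: a codeword of a tautology `φ` passes the
codeword test and, `textbookFrege` being complete (`FregeSystem.provable_iff_isTautology`,
`isFrege_textbookFrege_holds`), has a proof and hence an accepted certificate; conversely an
accepted pair `(w, c)` has `w = encode φ` (`mem_range_encode_of_chkTaut_nil`) with `φ` a
tautology (soundness of `V`). [cite: CookReckhow1979, §1 (Def. 1.3 and closing remark: conventional proof systems for TAUT fit Def. 1.3)] -/
theorem isProofSystemFor_tautVerifier {V : List Bool → List Bool → Bool}
    (hVpoly : IsPolyTimeVerifier V)
    (hsound : ∀ (φ : PropForm ℕ) (c : List Bool),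
      V (encodingPropForm.encode φ) c = true → φ.IsTautology)
    (hcomplete : ∀ (φ : PropForm ℕ) (π : List (PropForm ℕ)), textbookFrege.IsProofOf π φ →
      ∃ c : List Bool, V (encodingPropForm.encode φ) c = true) :
    IsProofSystemFor (tautVerifier V) TAUT := by
  have hF : IsFrege textbookFrege := isFrege_textbookFrege_holds
  refine ⟨isPolyTimeVerifier_tautVerifier hVpoly, fun w => ⟨?_, ?_⟩⟩
  · -- completeness: a codeword of a tautology has an accepted certificate
    rintro ⟨φ, hφ, rfl⟩
    obtain ⟨π, hπ⟩ := (FregeSystem.provable_iff_isTautology hF).2 hφ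
    obtain ⟨c, hc⟩ := hcomplete φ π hπ
    have h0 : chkTaut (encodingPropForm.encode φ) [] = false :=
      chkTaut_nil_eq_false_of_mem_TAUT ((mem_TAUT_iff φ).2 hφ)
    exact ⟨c, by simp [tautVerifier, h0, hc]⟩
  · -- soundness: an accepted pair has a codeword of a tautology as its first component
    rintro ⟨c, hc⟩
    simp only [tautVerifier, Bool.and_eq_true, Bool.not_eq_true'] at hc
    obtain ⟨φ, rfl⟩ := mem_range_encode_of_chkTaut_nil hc.1
    exact (mem_TAUT_iff φ).2 (hsound φ c hc.2)

/-- **Discharge of `exists_isProofSystemFor_TAUT`**: `TAUT` has a Cook–Reckhow proof system (in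
verifier form), namely `tautVerifier V` for the polynomial-time `textbookFrege` verifier `V` of
`textbookFrege_hasPolyTimeVerifier_holds` ("any conventional proof system for tautologies can
naturally be made to fit the definition of proof system in 1.3").
[cite: CookReckhow1979, §1 (Def. 1.3 and closing remark: conventional proof systems for TAUT fit Def. 1.3)] -/
theorem exists_isProofSystemFor_TAUT_holds : exists_isProofSystemFor_TAUT := by
  obtain ⟨V, hVpoly, hsound, q, hcomplete⟩ := textbookFrege_hasPolyTimeVerifier_holds
  exact ⟨tautVerifier V, isProofSystemFor_tautVerifier hVpoly hsound fun φ π hπ =>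
    (hcomplete φ π hπ).imp fun _ h => h.2⟩

end Literature.Computability.MetaComplexity
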